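import Mathlib.MeasureTheory.Measure.Hausdorff
import Mathlib.Geometry.Euclidean.Volume.Measure
import Mathlib.MeasureTheory.Integral.Bochner.Basic
import Mathlib.MeasureTheory.Integral.Bochner.Set
import Mathlib.MeasureTheory.Measure.Haar.InnerProductSpace
import Mathlib.Analysis.InnerProductSpace.Laplacian
import Mathlib.Analysis.Calculus.Gradient.Basic
import Literature.Analysis.FluidPDE.VectorCalculus
import HarnessLib

/-!
# Reilly's formula in flat space for a function constant on the boundary (sub-level-set form)

Topic `Geometry/Riemannian` (next to `LevelSetMeanCurvature.lean`, `LevelSetGaussBonnet.lean`);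
cite item `wi-23922` of route `NavierStokesRegularity/IsobarTomography` ("Reilly integrated Bochner
formula for a function constant on the boundary (flat case)"; identity (R) and the locality cap
(L) of that route are read through the named fact below, the pointwise engine
`div(Δf ∇f − ∇²f ∇f) = (Δf)² − |∇²f|²` being the route's own item `FlatBochnerDivergence`).
ONE named fact (D-0014), nothing else minted; a proved specialisation to `ℝ³`.

## Sources (read; page files under `lit read`)

* R. C. Reilly, *Applications of the Hessian operator in a Riemannian manifold*, Indiana Univ.
  Math. J. 26 (1977) 459–472 — the integral formula (the held copy `doi:10.1512/iumj.1977.26.26036`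
  is an un-OCRed scan; the statement is taken from the modern restatement below, which recovers
  "Reilly's original formula" as its case `V ≡ 1`). [Reilly1977]
* J. Li, C. Xia, *An integral formula and its applications on sub-static manifolds*, J.
  Differential Geom. 113 (2019) = arXiv:1603.02201, **Thm. 1.1** (p. 3) with §2 (p. 6, notation):
  for a bounded domain `Ω` with smooth boundary in a Riemannian manifold `(M, ḡ)`,
  `V, f ∈ C^∞(Ω̄)`, an identity whose case `V ≡ 1` is, verbatim, "Clearly, when `V ≡ 1` and
  `V·Q = Ric`, we recover Reilly's original formula":
  `∫_Ω (Δ̄f)² − |∇̄²f|² dΩ = ∫_∂Ω [h(∇z,∇z) + 2uΔz + H u²] dA + ∫_Ω Ric(∇̄f, ∇̄f) dΩ`,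
  "`ν` the outward unit normal vector, `z = f|_∂Ω`, `u = ∇̄_ν f`, `h(X,Y) = ḡ(∇̄_X ν, Y)` and
  `H = tr_ḡ h` the second fundamental form and the mean curvature (the sum of principal
  curvatures) of `∂Ω`". [LiXia2016]
* Flat level-set use (the consumer's setting): D. Stern, arXiv:1908.09754 §2; H. Bray, D. Kazaras,
  M. Khuri, D. Stern, arXiv:1911.06754 §§2–3 (Bochner's identity integrated over sub-level sets of
  a function with regular levels). [Stern2022] [BrayEtAl2022]

## The statement vendored (special case, in the tree's vocabulary)

Take `M = ℝⁿ` flat (`Ric = 0`) and `f = p` smooth on `ℝⁿ`, `Ω = {p < s}` a **regular sub-level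
set**: `{p ≤ s}` compact and `∇p ≠ 0` on `{p = s}`.  Then `Ω` is a bounded open set with smooth
boundary `∂Ω = {p = s}` (a compact regular level hypersurface, every point of which is a limit of
points of `Ω` because `∇p ≠ 0` there), `Ω̄ = {p ≤ s}`, `p ∈ C^∞(Ω̄)`, and `z = p|_∂Ω = s` is
constant, so `∇z = 0`, `Δz = 0` and the tangential boundary terms vanish; the outward unit normal
is `ν = ∇p/‖∇p‖` (`p` increases outwards), `u = ∂_ν p = ‖∇p‖`, and the mean curvature is
`H = tr h = div_∂Ω ν = div(∇p/‖∇p‖)` (ambient divergence of the unit gradient field, which is smooth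
near `∂Ω`; the normal component `⟨D_ν ν, ν⟩` vanishes since `‖ν‖ = 1`; sign: `H = (n−1)/r > 0` on the
round sphere of radius `r` with outward normal).  Reilly's formula becomes

  `∫_{p < s} [(Δp)² − ‖∇²p‖²_F] dx = ∫_{p = s} div(∇p/‖∇p‖) · ‖∇p‖² dℋⁿ⁻¹`,

with `∇²p(x) = D(∇p)(x) : ℝⁿ →L ℝⁿ` (Mathlib `fderiv ℝ (gradient p) x`), `‖·‖²_F` the tree's
`Literature.Analysis.FluidPDE.frobeniusNormSq`, `div` the tree's `Literature.Analysis.FluidPDE.VectorCalculus.divergence`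
(trace of the derivative), `Δ` Mathlib's `Laplacian.laplacian`, and `dA = dℋⁿ⁻¹` Mathlib's
**Euclidean** Hausdorff measure `μHE[n − 1]` (`Mathlib.Geometry.Euclidean.Volume.Measure`: the
Hausdorff measure rescaled so that `μHE[d]` is Lebesgue measure on `d`-dimensional Euclidean space
and is preserved by isometries — i.e. the normalised `ℋᵈ` of geometric measure theory, which on a
smooth hypersurface is its surface measure; NOT the raw `μH[n − 1]`, which on Euclidean space
differs from it by the isodiametric constant `2ᵈ/ω_d`).  Sanity check (by hand): `p = ‖x‖²`, `s = r²`: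
`Δp = 2n`, `‖∇²p‖²_F = 4n`, left side `4n(n−1)·vol Bᵣ`; right side `((n−1)/r)·(2r)²·|∂Bᵣ| =
4(n−1) r |∂Bᵣ| = 4n(n−1)·vol Bᵣ`.

* `reilly_flat_sublevel` — the named fact above, all dimensions `n`.
* `reilly_flat_sublevel.dim3` — PROVED from it: the case `ℝ³`, surface measure `μHE[2]` (the form
  route `IsobarTomography` consumes with `p` the pressure and `{p < s}` an isobaric region).
  -- TODO(general form): Reilly's formula on a compact Riemannian manifold with boundary, with the
  `Ric(∇f,∇f)` bulk term and the tangential boundary terms `2uΔz + h(∇z,∇z)` (Li–Xia Thm. 1.1 with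
  `V ≡ 1`), needs the tree's hypersurface vocabulary (`Literature.Geometry.Lorentzian.Hypersurface`)
  over Riemannian domains with boundary and is not vendored here; `C³` regularity of `p` suffices
  for the printed proof (divergence theorem for the `C¹` field `Δp∇p − ∇²p∇p`) but the sources state
  `C^∞`, which is what is vendored.

Not proved here: Mathlib has the divergence theorem only on boxes
(`MeasureTheory.integral_divergence_of_hasFDerivWithinAt_off_countable`), not on smooth bounded
domains, and no surface measure/mean curvature calculus for level hypersurfaces.
-/

noncomputable section

open MeasureTheory Set
open scoped RealInnerProductSpace ContDiff Laplacian

namespace Literature.Geometry.Riemannian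

open Literature.Analysis.FluidPDE

/-- **Reilly's formula in flat `ℝⁿ` for a function constant on the boundary, sub-level-set form**
(Reilly 1977; Li–Xia, J. Differential Geom. 113 (2019), Thm. 1.1 with `V ≡ 1`, `Ric = 0`,
`z = f|_∂Ω` constant: `∫_Ω (Δf)² − |∇²f|² = ∫_∂Ω H u²`, `u = ∂_ν f`, `ν` outward, `H` the sum of the
principal curvatures).  For `p : ℝⁿ → ℝ` smooth and `s ∈ ℝ` with `{p ≤ s}` compact and `∇p ≠ 0` on
`{p = s}` (so that `Ω = {p < s}` is a bounded open set with smooth boundary `{p = s}` on which `p`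
is constant, outward normal `∇p/‖∇p‖`, `∂_ν p = ‖∇p‖`, mean curvature `H = div(∇p/‖∇p‖)`):
`∫_{p<s} [(Δp)² − ‖D(∇p)‖²_F] dx = ∫_{p=s} div(∇p/‖∇p‖)·‖∇p‖² dℋⁿ⁻¹`.  Named fact (D-0014); users
take `(h : reilly_flat_sublevel)`.
[cite: LiXia2016, Thm. 1.1 (case V ≡ 1: "Reilly's original formula") and §2 (notation)]
[cite: Reilly1977, pp. 459–472 (the integral formula)] -/
def reilly_flat_sublevel : Prop :=
  ∀ (n : ℕ) (p : EuclideanSpace ℝ (Fin n) → ℝ) (s : ℝ), ContDiff ℝ ∞ p →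
    IsCompact {x | p x ≤ s} → (∀ x, p x = s → gradient p x ≠ 0) →
    ∫ x in {x | p x < s}, ((Δ p) x ^ 2 - frobeniusNormSq (fderiv ℝ (gradient p) x)) =
      ∫ x in p ⁻¹' {s},
        VectorCalculus.divergence (fun y => ‖gradient p y‖⁻¹ • gradient p y) x * ‖gradient p x‖ ^ 2
          ∂μHE[n - 1]

/-- **Reilly's flat formula on regular sub-level sets of `ℝ³`** (proved from the named fact, `n = 3`,
surface measure `μHE[2] = ℋ²`): for `p : ℝ³ → ℝ` smooth with `{p ≤ s}` compact and `∇p ≠ 0` on `{p = s}`,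
`∫_{p<s} [(Δp)² − ‖D(∇p)‖²_F] dx = ∫_{p=s} div(∇p/‖∇p‖)·‖∇p‖² dℋ²` — identity (R) of route
`IsobarTomography` for an isobaric region `{p < s}` of the pressure.
[cite: LiXia2016, Thm. 1.1 (case V ≡ 1)] -/
theorem reilly_flat_sublevel.dim3 (h : reilly_flat_sublevel) (p : EuclideanSpace ℝ (Fin 3) → ℝ)
    (s : ℝ) (hp : ContDiff ℝ ∞ p) (hc : IsCompact {x | p x ≤ s})
    (hr : ∀ x, p x = s → gradient p x ≠ 0) :
    ∫ x in {x | p x < s}, ((Δ p) x ^ 2 - frobeniusNormSq (fderiv ℝ (gradient p) x)) =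
      ∫ x in p ⁻¹' {s},
        VectorCalculus.divergence (fun y => ‖gradient p y‖⁻¹ • gradient p y) x * ‖gradient p x‖ ^ 2
          ∂μHE[2] := by
  have h3 := h 3 p s hp hc hr
  norm_num at h3
  exact h3

end Literature.Geometry.Riemannian
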